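import Summits.QuantumFields.YangMills.Theorems.BalabanLadderNTClassicalShadowOrbit
import HarnessLib

/-!
# Crux `NT` (stmt-QuantumFields-19353), stub `stub_refpkgT : RefPkgT`: THE CLASSICAL SHADOW, IX — the orbit test for CLAUSE 3
# (zero-temperature conditional third cumulant of a one-orbit degenerate box = orbit third cumulant of the classical density field)

Helper file (`--supports stmt-QuantumFields-19353`) of the fleet lead prover of crux `NT` (unit `ym-spine-19353-p1`, GEN 14); sequel
of `…NTClassicalShadowOrbit` (p601276; two-point) and `…ThreeValley` (p600646; the `ℤ₃` special case).

* **`tendsto_kerK3_of_orbit`** — finite family of kernel symmetries `γ i`, orbit sums of the seven observables `dens_x, dens_y, dens_z,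
  dens_x dens_y, dens_x dens_z, dens_y dens_z, dens_x dens_y dens_z` constant (`M₁, M₂, M₃, M₁₂, M₁₃, M₂₃, M₁₂₃`) on the ground states, kernel
  symmetric on them ⇒ `kerK3^η_β(x,y,z) → M₁₂₃/k − (M₁M₂₃ + M₂M₁₃ + M₃M₁₂)/k² + 2M₁M₂M₃/k³` (`k = |ι|`), the orbit third cumulant;
* **`orbitK3_le_of_e3osc`** — clause 3 ⇒ `|orbit third cumulant| ≤ C₃ / min(d)⁴ / (1 + min sep)⁸` (depths `≥ 2`).

HONEST FRAMING.  Consequences of the registered clause 3 at fixed lattice geometry as `β → ∞`; symmetry and one-orbit structure are hypotheses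
(symmetry now tree-supplied for every lattice symmetry of a box: permutations, translations, gauge, time reflection); no floor, not AF, not
NT, not the seam, not the gap; not Clay.
-/

set_option autoImplicit false

noncomputable section

open MeasureTheory Filter Topology
open Literature.MathematicalPhysics.QuantumFieldTheory Literature.MathematicalPhysics.QuantumLattice
open Literature.Probability.LatticeModels
open Summit.QuantumFields.YangMills.Cruxes.OSLegsFromFemtoAndGap.DlrCollarTransfer
open Summit.QuantumFields.YangMills.Cruxes.UVSeamRec.BoundaryLawPenetration

namespace Summit.QuantumFields.YangMills.Cruxes.NT.ClassicalShadow

variable {G : Type} [Group G] [TopologicalSpace G] [IsTopologicalGroup G] [CompactSpace G]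
  [MeasurableSpace G] [BorelSpace G] (r : LatticeRep G)

section Orbit

variable (c : Fin 4 → ℤ) (b : ℕ) (η : LGConfig 4 G) {ι : Type} [Fintype ι] [Nonempty ι]

/-- **Orbit test, three-point**: the zero-temperature conditional third cumulant of a one-orbit degenerate box is the orbit third cumulant of
the classical density field. [folklore] -/
theorem tendsto_kerK3_of_orbit (γ : ι → LGConfig 4 G → LGConfig 4 G) (hγ : ∀ i, Continuous (γ i))
    {x y z : Fin 4 → ℤ} {M₁ M₂ M₃ M₁₂ M₁₃ M₂₃ M₁₂₃ : ℝ}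
    (h₁ : ∀ ζ ∈ cubeMinimisers G r c b η, ∑ i, dens G r x (γ i (glueWith (cubeEdges c b) ζ η)) = M₁)
    (h₂ : ∀ ζ ∈ cubeMinimisers G r c b η, ∑ i, dens G r y (γ i (glueWith (cubeEdges c b) ζ η)) = M₂)
    (h₃ : ∀ ζ ∈ cubeMinimisers G r c b η, ∑ i, dens G r z (γ i (glueWith (cubeEdges c b) ζ η)) = M₃)
    (h₁₂ : ∀ ζ ∈ cubeMinimisers G r c b η,
      ∑ i, dens G r x (γ i (glueWith (cubeEdges c b) ζ η)) * dens G r y (γ i (glueWith (cubeEdges c b) ζ η)) = M₁₂)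
    (h₁₃ : ∀ ζ ∈ cubeMinimisers G r c b η,
      ∑ i, dens G r x (γ i (glueWith (cubeEdges c b) ζ η)) * dens G r z (γ i (glueWith (cubeEdges c b) ζ η)) = M₁₃)
    (h₂₃ : ∀ ζ ∈ cubeMinimisers G r c b η,
      ∑ i, dens G r y (γ i (glueWith (cubeEdges c b) ζ η)) * dens G r z (γ i (glueWith (cubeEdges c b) ζ η)) = M₂₃)
    (h₁₂₃ : ∀ ζ ∈ cubeMinimisers G r c b η,
      ∑ i, dens G r x (γ i (glueWith (cubeEdges c b) ζ η)) * dens G r y (γ i (glueWith (cubeEdges c b) ζ η)) *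
        dens G r z (γ i (glueWith (cubeEdges c b) ζ η)) = M₁₂₃)
    (s₁ : ∀ (β : ℝ) (i : ι), kerE G r β c b η (dens G r x ∘ γ i) = kerE G r β c b η (dens G r x))
    (s₂ : ∀ (β : ℝ) (i : ι), kerE G r β c b η (dens G r y ∘ γ i) = kerE G r β c b η (dens G r y))
    (s₃ : ∀ (β : ℝ) (i : ι), kerE G r β c b η (dens G r z ∘ γ i) = kerE G r β c b η (dens G r z))
    (s₁₂ : ∀ (β : ℝ) (i : ι), kerE G r β c b η ((fun U => dens G r x U * dens G r y U) ∘ γ i) =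
      kerE G r β c b η (fun U => dens G r x U * dens G r y U))
    (s₁₃ : ∀ (β : ℝ) (i : ι), kerE G r β c b η ((fun U => dens G r x U * dens G r z U) ∘ γ i) =
      kerE G r β c b η (fun U => dens G r x U * dens G r z U))
    (s₂₃ : ∀ (β : ℝ) (i : ι), kerE G r β c b η ((fun U => dens G r y U * dens G r z U) ∘ γ i) =
      kerE G r β c b η (fun U => dens G r y U * dens G r z U))
    (s₁₂₃ : ∀ (β : ℝ) (i : ι), kerE G r β c b η ((fun U => dens G r x U * dens G r y U * dens G r z U) ∘ γ i) =
      kerE G r β c b η (fun U => dens G r x U * dens G r y U * dens G r z U)) :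
    Tendsto (fun β : ℝ => kerK3 G r β c b η x y z) atTop
      (𝓝 (M₁₂₃ / Fintype.card ι - M₁ / Fintype.card ι * (M₂₃ / Fintype.card ι) - M₂ / Fintype.card ι * (M₁₃ / Fintype.card ι) -
        M₃ / Fintype.card ι * (M₁₂ / Fintype.card ι) +
        2 * (M₁ / Fintype.card ι * (M₂ / Fintype.card ι) * (M₃ / Fintype.card ι)))) := by
  have hX := tendsto_kerE_of_orbit r c b η γ (fun i => (continuous_dens r x).comp (hγ i)) h₁ s₁
  have hY := tendsto_kerE_of_orbit r c b η γ (fun i => (continuous_dens r y).comp (hγ i)) h₂ s₂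
  have hZ := tendsto_kerE_of_orbit r c b η γ (fun i => (continuous_dens r z).comp (hγ i)) h₃ s₃
  have hXY := tendsto_kerE_of_orbit r c b η γ (F := fun U => dens G r x U * dens G r y U)
    (fun i => ((continuous_dens r x).mul (continuous_dens r y)).comp (hγ i)) h₁₂ s₁₂
  have hXZ := tendsto_kerE_of_orbit r c b η γ (F := fun U => dens G r x U * dens G r z U)
    (fun i => ((continuous_dens r x).mul (continuous_dens r z)).comp (hγ i)) h₁₃ s₁₃
  have hYZ := tendsto_kerE_of_orbit r c b η γ (F := fun U => dens G r y U * dens G r z U)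
    (fun i => ((continuous_dens r y).mul (continuous_dens r z)).comp (hγ i)) h₂₃ s₂₃
  have hXYZ := tendsto_kerE_of_orbit r c b η γ (F := fun U => dens G r x U * dens G r y U * dens G r z U)
    (fun i => (((continuous_dens r x).mul (continuous_dens r y)).mul (continuous_dens r z)).comp (hγ i)) h₁₂₃ s₁₂₃
  have h := (((hXYZ.sub (hX.mul hYZ)).sub (hY.mul hXZ)).sub (hZ.mul hXY)).add ((hX.mul hY).mul hZ |>.const_mul 2)
  refine h.congr' (Eventually.of_forall fun β => ?_)
  simp only [kerK3]

end Orbit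

section Price

variable (a : ℝ → ℝ) {ι : Type} [Fintype ι] [Nonempty ι]

/-- **Clause 3 prices a one-orbit degenerate box by the orbit third cumulant of its density field**:
`|κ₃,Γ| ≤ C₃ / min(d_x,d_y,d_z)⁴ / (1 + min(‖y−x‖,‖z−y‖,‖z−x‖))⁸`. [folklore] -/
theorem orbitK3_le_of_e3osc (ha0 : Tendsto a atTop (𝓝 0)) {C₃ ℓ : ℝ} (hℓ : 0 < ℓ)
    (hE3 : ∃ β₃ : ℝ, ∀ β : ℝ, β₃ ≤ β → ∀ (c : Fin 4 → ℤ) (b : ℕ), (b : ℝ) * a β ≤ ℓ →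
      ∀ (η η' : LGConfig 4 G) (x y z : Fin 4 → ℤ), 1 ≤ depth c b x → 1 ≤ depth c b y → 1 ≤ depth c b z →
        |kerK3 G r β c b η x y z - kerK3 G r β c b η' x y z| ≤
          C₃ / ((min (min (depth c b x) (depth c b y)) (depth c b z) : ℕ) : ℝ) ^ 4 /
            (1 + min (min ‖siteToE (y - x)‖ ‖siteToE (z - y)‖) ‖siteToE (z - x)‖) ^ 8)
    (c : Fin 4 → ℤ) (b : ℕ) (η : LGConfig 4 G) (γ : ι → LGConfig 4 G → LGConfig 4 G) (hγ : ∀ i, Continuous (γ i))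
    {x y z : Fin 4 → ℤ} (hx : 2 ≤ depth c b x) (hy : 2 ≤ depth c b y) (hz : 2 ≤ depth c b z)
    {M₁ M₂ M₃ M₁₂ M₁₃ M₂₃ M₁₂₃ : ℝ}
    (h₁ : ∀ ζ ∈ cubeMinimisers G r c b η, ∑ i, dens G r x (γ i (glueWith (cubeEdges c b) ζ η)) = M₁)
    (h₂ : ∀ ζ ∈ cubeMinimisers G r c b η, ∑ i, dens G r y (γ i (glueWith (cubeEdges c b) ζ η)) = M₂)
    (h₃ : ∀ ζ ∈ cubeMinimisers G r c b η, ∑ i, dens G r z (γ i (glueWith (cubeEdges c b) ζ η)) = M₃)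
    (h₁₂ : ∀ ζ ∈ cubeMinimisers G r c b η,
      ∑ i, dens G r x (γ i (glueWith (cubeEdges c b) ζ η)) * dens G r y (γ i (glueWith (cubeEdges c b) ζ η)) = M₁₂)
    (h₁₃ : ∀ ζ ∈ cubeMinimisers G r c b η,
      ∑ i, dens G r x (γ i (glueWith (cubeEdges c b) ζ η)) * dens G r z (γ i (glueWith (cubeEdges c b) ζ η)) = M₁₃)
    (h₂₃ : ∀ ζ ∈ cubeMinimisers G r c b η,
      ∑ i, dens G r y (γ i (glueWith (cubeEdges c b) ζ η)) * dens G r z (γ i (glueWith (cubeEdges c b) ζ η)) = M₂₃)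
    (h₁₂₃ : ∀ ζ ∈ cubeMinimisers G r c b η,
      ∑ i, dens G r x (γ i (glueWith (cubeEdges c b) ζ η)) * dens G r y (γ i (glueWith (cubeEdges c b) ζ η)) *
        dens G r z (γ i (glueWith (cubeEdges c b) ζ η)) = M₁₂₃)
    (s₁ : ∀ (β : ℝ) (i : ι), kerE G r β c b η (dens G r x ∘ γ i) = kerE G r β c b η (dens G r x))
    (s₂ : ∀ (β : ℝ) (i : ι), kerE G r β c b η (dens G r y ∘ γ i) = kerE G r β c b η (dens G r y))
    (s₃ : ∀ (β : ℝ) (i : ι), kerE G r β c b η (dens G r z ∘ γ i) = kerE G r β c b η (dens G r z))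
    (s₁₂ : ∀ (β : ℝ) (i : ι), kerE G r β c b η ((fun U => dens G r x U * dens G r y U) ∘ γ i) =
      kerE G r β c b η (fun U => dens G r x U * dens G r y U))
    (s₁₃ : ∀ (β : ℝ) (i : ι), kerE G r β c b η ((fun U => dens G r x U * dens G r z U) ∘ γ i) =
      kerE G r β c b η (fun U => dens G r x U * dens G r z U))
    (s₂₃ : ∀ (β : ℝ) (i : ι), kerE G r β c b η ((fun U => dens G r y U * dens G r z U) ∘ γ i) =
      kerE G r β c b η (fun U => dens G r y U * dens G r z U))
    (s₁₂₃ : ∀ (β : ℝ) (i : ι), kerE G r β c b η ((fun U => dens G r x U * dens G r y U * dens G r z U) ∘ γ i) =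
      kerE G r β c b η (fun U => dens G r x U * dens G r y U * dens G r z U)) :
    |M₁₂₃ / Fintype.card ι - M₁ / Fintype.card ι * (M₂₃ / Fintype.card ι) - M₂ / Fintype.card ι * (M₁₃ / Fintype.card ι) -
        M₃ / Fintype.card ι * (M₁₂ / Fintype.card ι) +
        2 * (M₁ / Fintype.card ι * (M₂ / Fintype.card ι) * (M₃ / Fintype.card ι))| ≤
      C₃ / ((min (min (depth c b x) (depth c b y)) (depth c b z) : ℕ) : ℝ) ^ 4 /
        (1 + min (min ‖siteToE (y - x)‖ ‖siteToE (z - y)‖) ‖siteToE (z - x)‖) ^ 8 := by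
  obtain ⟨β₃, H3⟩ := hE3
  have hlim : Tendsto (fun β : ℝ => |kerK3 G r β c b η x y z - kerK3 G r β c b 1 x y z|) atTop
      (𝓝 |M₁₂₃ / Fintype.card ι - M₁ / Fintype.card ι * (M₂₃ / Fintype.card ι) - M₂ / Fintype.card ι * (M₁₃ / Fintype.card ι) -
        M₃ / Fintype.card ι * (M₁₂ / Fintype.card ι) +
        2 * (M₁ / Fintype.card ι * (M₂ / Fintype.card ι) * (M₃ / Fintype.card ι))|) := by
    have h := ((tendsto_kerK3_of_orbit r c b η γ hγ h₁ h₂ h₃ h₁₂ h₁₃ h₂₃ h₁₂₃ s₁ s₂ s₃ s₁₂ s₁₃ s₂₃ s₁₂₃).sub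
      (tendsto_kerK3_one r c b hx hy hz)).abs
    rwa [sub_zero] at h
  refine le_of_tendsto hlim ?_
  filter_upwards [eventually_mul_le_of_tendsto_zero ha0 hℓ b, eventually_ge_atTop β₃] with β hb hβ3
  exact H3 β hβ3 c b hb η 1 x y z (le_trans one_le_two hx) (le_trans one_le_two hy) (le_trans one_le_two hz)

end Price

end Summit.QuantumFields.YangMills.Cruxes.NT.ClassicalShadow

end
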